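import Literature.Analysis.FluidPDE.TaoAveragedPlaneWaveSynthesisW
import HarnessLib

/-!
# Tao 2016, §3.5–§3.6 about a general base triple: (3.9) without dilations from a joint-weight
# rotation identity (3.15)/(3.16) about `ξ`

T. Tao, *Finite time blowup for an averaged three-dimensional Navier–Stokes equation*,
J. Amer. Math. Soc. **29** (2016), 601–674 = arXiv:1402.0290v3, §3.5 (3.13) and §3.6
(3.15)–(3.16), p. 18 ("Inserting this expansion into (3.16), we obtain the desired expansion
(3.15)"). Sequel of `TaoAveragedSymbolExtractionAt.lean` ((3.9) about `ξ` from the integrated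
tensor identity (3.13) about `ξ`) and `TaoAveragedPlaneWaveSynthesisW.lean` (the plane-wave synthesis
for the weight of `B_{η,ρ,0;ξ}`): the analogue about `ξ` of the tree's
`singleScale_isComplexAverageNoDil_of_steps` / `rotationAverage_tensorIdentity_of_steps` (the `xi0`
case, `TaoAveragedRotationAveraging.lean`). HONEST FRAMING (cell harvest/h2-tao-ladder, TAO-LADDER rung
M_1 — MODEL statements about Tao's averaged equation): groundwork for the rung-1 crux
`SingleScaleNoDilAt`. After this file, proving the crux at a base triple `ξ` amounts EXACTLY to
producing data `(d, μ₀, E, F)` with the joint-weight identity about `ξ` — the analogue of the named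
fact `rotationAverage_jointWeight` (§3.6–§3.9, proved in the tree at `xi0` only) — which is NOT
asserted here (it appears as a hypothesis). Nothing here concerns the true Navier–Stokes equations.

* `singleScaleAt_isComplexAverageNoDil_of_jointWeightAt` — if some finite measure `μ₀` on
  `(Fin d → ℝ³)`, measurable rotation family `E` and smooth compactly supported joint weight `F`
  satisfy `jointWeightAverageW μ₀ E (φ η_ξ) F X₁ X₂ X₃ = ∏ⱼ ∫ Xⱼ · \overline{ψ̂ⱼ}` for all
  `Xⱼ ∈ L¹ ∩ L²` with `Xⱼ(ζ) ⊥ ζ` a.e., then `C₀ = ⟨u,ψ̄₁⟩⟨v,ψ̄₂⟩⟨w,ψ̄₃⟩` is a DILATION-FREE complex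
  average of `B_{η,ρ,0;ξ}` (datum: `PlaneWave.datum μ₀ E F`).

## References

* T. Tao, J. Amer. Math. Soc. 29 (2016), 601–674, arXiv:1402.0290v3, §3.4 (3.9), §3.5 (3.13),
  §3.6 (3.15)–(3.16) p. 18, Remark 3.5 p. 20. Key `Tao2016AveragedNS`.
-/

noncomputable section

open MeasureTheory Set Filter FourierTransform
open scoped ENNReal NNReal SchwartzMap ComplexConjugate

namespace Literature.Analysis.FluidPDE.Tao2016

/-- **(3.9) about `ξ` without dilations from a joint-weight identity about `ξ`** (§3.5 + §3.6 last
paragraph, with `ξ⁰ ↦ ξ`): given `(d, μ₀, E, F)` — a finite measure on `(Fin d → ℝ³)`, a measurable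
family of rotations and a smooth compactly supported joint weight — such that for all frequency
functions `X₁, X₂, X₃ ∈ L¹ ∩ L²` with `Xⱼ(ζ) ⊥ ζ` a.e.
`jointWeightAverageW μ₀ E (φ(|·-ξ 0|/ε₀²) η_ξ) F X₁ X₂ X₃ = ∏ⱼ ∫ Xⱼ(ζ) · \overline{ψ̂ⱼ(ζ)} dζ`,
the single-scale form `C₀` of the profiles `ψ` is a dilation-free complex average of `B_{η,ρ,0;ξ}`
(plane-wave synthesis `planeWaveSynthesisAt`, then `singleScaleAt_isComplexAverageNoDil_of_tensorIdentityAt`).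
The hypothesis is proved in the source only at `ξ = xi0` (§3.6–§3.9); it is NOT asserted here.
[cite: Tao2016AveragedNS, §3.5 (3.13) and §3.6 p. 18; Remark 3.5 p. 20] -/
theorem singleScaleAt_isComplexAverageNoDil_of_jointWeightAt
    (ξ : Fin 3 → EuclideanSpace ℝ (Fin 3)) (ε₀ : ℝ)
    (ψ : Fin 3 → 𝓢(EuclideanSpace ℝ (Fin 3), EuclideanSpace ℂ (Fin 3)))
    {d : ℕ} (μ₀ : Measure (Fin d → EuclideanSpace ℝ (Fin 3))) [IsFiniteMeasure μ₀]
    {E : Fin 3 → (Fin d → EuclideanSpace ℝ (Fin 3)) →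
      (EuclideanSpace ℝ (Fin 3) ≃ₗᵢ[ℝ] EuclideanSpace ℝ (Fin 3))} (hE : IsRotationFamily E)
    {F : (Fin d → EuclideanSpace ℝ (Fin 3)) × (EuclideanSpace ℝ (Fin 3) × EuclideanSpace ℝ (Fin 3)) → ℂ}
    (hF : ContDiff ℝ ((⊤ : ℕ∞) : WithTop ℕ∞) F) (hFc : HasCompactSupport F)
    (hid : ∀ X₁ X₂ X₃ : EuclideanSpace ℝ (Fin 3) → EuclideanSpace ℂ (Fin 3),
      FreqIntegrable X₁ → FreqIntegrable X₂ → FreqIntegrable X₃ →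
      FreqDivFree X₁ → FreqDivFree X₂ → FreqDivFree X₃ →
        jointWeightAverageW μ₀ E (singleScaleWeightAtC ξ ε₀) F X₁ X₂ X₃ =
          (∫ ζ, cdot (X₁ ζ) (conj3 (𝓕 (⇑(ψ 0)) ζ))) * (∫ ζ, cdot (X₂ ζ) (conj3 (𝓕 (⇑(ψ 1)) ζ))) *
            ∫ ζ, cdot (X₃ ζ) (conj3 (𝓕 (⇑(ψ 2)) ζ))) :
    IsComplexAverageNoDilOf (singleScaleForm (ψ 0) (ψ 1) (ψ 2)) (betaRhoZeroFormAt ξ ε₀) := by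
  obtain ⟨𝒟, hlam, h𝒟⟩ := planeWaveSynthesisAt ξ ε₀ d μ₀ hE hF hFc
  refine singleScaleAt_isComplexAverageNoDil_of_tensorIdentityAt ξ ε₀ ψ 𝒟 hlam fun u v w hu hv hw => ?_
  rw [h𝒟 _ _ _ hu.freqIntegrable_fourierFn hv.freqIntegrable_fourierFn hw.freqIntegrable_fourierFn]
  exact hid _ _ _ hu.freqIntegrable_fourierFn hv.freqIntegrable_fourierFn hw.freqIntegrable_fourierFn
    hu.freqDivFree_fourierFn hv.freqDivFree_fourierFn hw.freqDivFree_fourierFn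

end Literature.Analysis.FluidPDE.Tao2016
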